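import Mathlib.Analysis.SpecialFunctions.Trigonometric.Inverse
import Mathlib.Analysis.SpecialFunctions.Sqrt
import Summits.Ventures.PackingBounds.Configurations.SquareAntiprism

/-!
# The vertex star of the optimal square antiprism closes exactly: `3 φ₁ + φ₂ = 2π`

Framing: lottery ticket; floor = certified bounds/negative ranges. Venture `PackingBounds` (cell
`pub-packcert`, seat `pub-packcert-recog`, gen 14). Kind (c)/method: the (+) control of the seat's
exact star-assembly argument (HOME `RECOG.md` §21, `T3.md` §15 (i)), companion of
`Configurations/SnubCubeVertexStar.lean`, for the Tammes `N = 8` configuration of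
`Configurations/SquareAntiprism.lean` (largest inner product `s = (2√2 - 1)/7`).

Every vertex of the optimal square antiprism has four nearest neighbours; consecutive ones that are
nearest neighbours of each other are separated about the vertex by the azimuth
`φ₁ = arccos (s/(1+s)) = arccos ((√2 - 1)/2)`, and the two neighbours in the vertex's own square
(inner product `u₂ = (4√2 - 9)/7`, the square's diagonal) by `φ₂ = arccos ((u₂ - s²)/(1 - s²)) = arccos (√2 - 2)`.
We prove `T₃(s/(1+s)) = (u₂ - s²)/(1 - s²)` exactly in `ℚ(√2)` and deduce `3 φ₁ + φ₂ = 2π`: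
three triangles and one square corner fill the full angle.
-/

namespace Summit.Ventures.PackingBounds.Config.AntiprismStar

/-- `s = (2√2 - 1)/7`, the largest inner product of the optimal square antiprism (`cos θ₈`). -/
noncomputable def s : ℝ := (2 * Real.sqrt 2 - 1) / 7

/-- `u₂ = (4√2 - 9)/7`, the inner product across the diagonal of a square face. -/
noncomputable def u2 : ℝ := (4 * Real.sqrt 2 - 9) / 7

/-- `γ₁ = cos φ₁ = s/(1+s)`. -/
noncomputable def γ1 : ℝ := s / (1 + s)

/-- `γ₂ = cos φ₂ = (u₂ - s²)/(1 - s²)`. -/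
noncomputable def γ2 : ℝ := (u2 - s ^ 2) / (1 - s ^ 2)

/-- Enclosure `0.26 < s < 0.27` (from `1.41 < √2 < 1.42`). -/
theorem s_bounds : (0.26 : ℝ) < s ∧ s < 0.27 := by
  have h1 : (1.41 : ℝ) < Real.sqrt 2 := by
    rw [show (1.41 : ℝ) = Real.sqrt (1.41 ^ 2) by rw [Real.sqrt_sq (by norm_num)]]
    exact Real.sqrt_lt_sqrt (by norm_num) (by norm_num)
  have h2 : Real.sqrt 2 < (1.42 : ℝ) := by
    rw [show (1.42 : ℝ) = Real.sqrt (1.42 ^ 2) by rw [Real.sqrt_sq (by norm_num)]]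
    exact Real.sqrt_lt_sqrt (by norm_num) (by norm_num)
  unfold s; constructor <;> linarith

/-- The key exact identity in `ℚ(√2)`, denominators cleared:
`(1 - s²)(4 s³ - 3 s (1+s)²) = (u₂ - s²)(1+s)³`. -/
theorem key_poly : (1 - s ^ 2) * (4 * s ^ 3 - 3 * s * (1 + s) ^ 2) = (u2 - s ^ 2) * (1 + s) ^ 3 := by
  unfold s u2
  have h : Real.sqrt 2 ^ 2 = 2 := Real.sq_sqrt (by norm_num)
  linear_combination ((-192/343 : ℝ) + (-16/343 : ℝ) * Real.sqrt 2 + (16/343 : ℝ) * Real.sqrt 2 ^ 2) * h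

/-- `T₃(γ₁) = γ₂`: `4 γ₁³ - 3 γ₁ = γ₂` exactly. -/
theorem T3_identity : 4 * γ1 ^ 3 - 3 * γ1 = γ2 := by
  obtain ⟨hs1, hs2⟩ := s_bounds
  have h1 : (1 + s) ≠ 0 := by intro h; linarith
  have h2 : (1 - s ^ 2) ≠ 0 := by nlinarith
  have h13 : (1 + s) ^ 3 ≠ 0 := pow_ne_zero 3 h1
  unfold γ1 γ2
  rw [div_pow, eq_div_iff h2]
  have key := key_poly
  field_simp
  linear_combination key

/-- `-1/2 < γ₁ < 1/2`, i.e. `φ₁ ∈ (π/3, 2π/3)`; indeed `γ₁ = (√2 - 1)/2 ≈ 0.207`. -/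
theorem γ1_bounds : -(1/2 : ℝ) < γ1 ∧ γ1 < 1/2 := by
  obtain ⟨hs1, hs2⟩ := s_bounds
  unfold γ1
  constructor
  · rw [lt_div_iff₀ (by linarith)]; linarith
  · rw [div_lt_iff₀ (by linarith)]; linarith

/-- `-1 ≤ γ₂ ≤ 1` (indeed `γ₂ = √2 - 2 ≈ -0.586`). -/
theorem γ2_mem : -1 ≤ γ2 ∧ γ2 ≤ 1 := by
  rw [← T3_identity]
  obtain ⟨h0, h1⟩ := γ1_bounds
  constructor <;> nlinarith [sq_nonneg (γ1 + 1/2), sq_nonneg (γ1 - 1/2), sq_nonneg γ1]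

/-- **The vertex star of the optimal square antiprism closes**: `3 arccos γ₁ + arccos γ₂ = 2π`. -/
theorem vertex_star_closes : 3 * Real.arccos γ1 + Real.arccos γ2 = 2 * Real.pi := by
  obtain ⟨hγ0, hγ1⟩ := γ1_bounds
  have hγ2 := γ2_mem
  -- φ := arccos γ₁ ∈ (π/3, 2π/3): compare with arccos (1/2) = π/3 and arccos (-1/2) = 2π/3
  have e1 : Real.arccos (1 / 2 : ℝ) = Real.pi / 3 := by
    rw [← Real.cos_pi_div_three, Real.arccos_cos (by positivity) (by linarith [Real.pi_pos])]
  have hφ_gt : Real.pi / 3 < Real.arccos γ1 := by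
    have h := Real.arccos_lt_arccos (by linarith) hγ1 (by norm_num)
    rw [e1] at h; exact h
  have hφ_lt : Real.arccos γ1 < 2 * Real.pi / 3 := by
    have h := Real.arccos_lt_arccos (by norm_num) hγ0 (by linarith)
    have e : Real.arccos (-(1 / 2 : ℝ)) = 2 * Real.pi / 3 := by
      rw [Real.arccos_neg, e1]; ring
    rw [e] at h; exact h
  have hcos : Real.cos (Real.arccos γ1) = γ1 := Real.cos_arccos (by linarith) (by linarith)
  have h3 : Real.cos (3 * Real.arccos γ1) = γ2 := by
    rw [Real.cos_three_mul, hcos, T3_identity]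
  have hψ : Real.arccos γ2 = 2 * Real.pi - 3 * Real.arccos γ1 := by
    have hc : Real.cos (2 * Real.pi - 3 * Real.arccos γ1) = γ2 := by
      rw [Real.cos_two_pi_sub, h3]
    rw [← hc, Real.arccos_cos (by linarith) (by linarith [Real.pi_pos])]
  linarith

/-! ### Tie to the configuration of `Configurations/SquareAntiprism.lean` (appended)

`s` and `u₂` are normalised keys of the antiprism's exact distance table `Config.SquareAntiprism.table`
(dot products of the `ℤ[α]` coordinate vectors, `α⁴ = 2`, common squared length `q = 4 + α²`):
`s = ι⟨0,0,1,0⟩/ι q = α²/(4 + α²)` is the largest key (multiplicity `4`: the four nearest neighbours)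
and `u₂ = ι⟨-4,0,1,0⟩/ι q` the key of multiplicity `1` (the square diagonal). -/

/-- `s = α²/(4 + α²)`: the multiplicity-`4` key of `Config.SquareAntiprism.table`, normalised by `q`. -/
theorem s_eq_table_key :
    s = QuarticTwoInt.toReal ⟨0, 0, 1, 0⟩ / QuarticTwoInt.toReal SquareAntiprism.q := by
  have hsq : Real.sqrt 2 ^ 2 = 2 := Real.sq_sqrt (by norm_num)
  have h1 : (1.41 : ℝ) < Real.sqrt 2 := by
    rw [show (1.41 : ℝ) = Real.sqrt (1.41 ^ 2) by rw [Real.sqrt_sq (by norm_num)]]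
    exact Real.sqrt_lt_sqrt (by norm_num) (by norm_num)
  have hq : (0 : ℝ) < QuarticTwoInt.toReal SquareAntiprism.q := by
    rw [QuarticTwoInt.toReal_apply, SquareAntiprism.q, QuarticTwoInt.alpha_sq]; push_cast; nlinarith
  rw [eq_div_iff hq.ne', QuarticTwoInt.toReal_apply, QuarticTwoInt.toReal_apply, SquareAntiprism.q, s,
    QuarticTwoInt.alpha_sq]
  push_cast
  linear_combination (2/7 : ℝ) * hsq

/-- `(⟨0, 0, 1, 0⟩, 4) ∈ Config.SquareAntiprism.table`. -/
theorem s_key_mem_table : (⟨0, 0, 1, 0⟩, 4) ∈ SquareAntiprism.table := by decide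

/-- `u₂ = (α² - 4)/(4 + α²)`: the multiplicity-`1` key of `Config.SquareAntiprism.table`, normalised. -/
theorem u2_eq_table_key :
    u2 = QuarticTwoInt.toReal ⟨-4, 0, 1, 0⟩ / QuarticTwoInt.toReal SquareAntiprism.q := by
  have hsq : Real.sqrt 2 ^ 2 = 2 := Real.sq_sqrt (by norm_num)
  have h1 : (1.41 : ℝ) < Real.sqrt 2 := by
    rw [show (1.41 : ℝ) = Real.sqrt (1.41 ^ 2) by rw [Real.sqrt_sq (by norm_num)]]
    exact Real.sqrt_lt_sqrt (by norm_num) (by norm_num)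
  have hq : (0 : ℝ) < QuarticTwoInt.toReal SquareAntiprism.q := by
    rw [QuarticTwoInt.toReal_apply, SquareAntiprism.q, QuarticTwoInt.alpha_sq]; push_cast; nlinarith
  rw [eq_div_iff hq.ne', QuarticTwoInt.toReal_apply, QuarticTwoInt.toReal_apply, SquareAntiprism.q, u2,
    QuarticTwoInt.alpha_sq]
  push_cast
  linear_combination (4/7 : ℝ) * hsq

/-- `(⟨-4, 0, 1, 0⟩, 1) ∈ Config.SquareAntiprism.table`. -/
theorem u2_key_mem_table : (⟨-4, 0, 1, 0⟩, 1) ∈ SquareAntiprism.table := by decide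

/-- `s` is the largest normalised key of the table (cf. `SquareAntiprism.inner_pts`). -/
theorem table_keys_le_s :
    ∀ p ∈ SquareAntiprism.table, QuarticTwoInt.toReal p.1 / QuarticTwoInt.toReal SquareAntiprism.q ≤ s := by
  have hsq : Real.sqrt 2 ^ 2 = 2 := Real.sq_sqrt (by norm_num)
  have h1 : (1.41 : ℝ) < Real.sqrt 2 := by
    rw [show (1.41 : ℝ) = Real.sqrt (1.41 ^ 2) by rw [Real.sqrt_sq (by norm_num)]]
    exact Real.sqrt_lt_sqrt (by norm_num) (by norm_num)
  have hq : (0 : ℝ) < QuarticTwoInt.toReal SquareAntiprism.q := by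
    rw [QuarticTwoInt.toReal_apply, SquareAntiprism.q, QuarticTwoInt.alpha_sq]; push_cast; nlinarith
  intro p hp
  rw [div_le_iff₀ hq, QuarticTwoInt.toReal_apply, QuarticTwoInt.toReal_apply, SquareAntiprism.q, s]
  simp only [SquareAntiprism.table, List.mem_cons, List.not_mem_nil, or_false] at hp
  rcases hp with rfl | rfl | rfl <;> push_cast <;>
    simp only [QuarticTwoInt.alpha_sq, zero_mul, add_zero, zero_add] <;> nlinarith

end Summit.Ventures.PackingBounds.Config.AntiprismStar
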